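import Summits.BirchSwinnertonDyer.Rank1Residual.X5.TwoAdicInstancesMultAnchorsA
import HarnessLib

/-!
# X5 at `p = 2` (cell `bsd-2adic`, seat `bsd-2adic-mult`, GEN 3): the NON-SPLIT ANCHOR references of door
# (34-GV-mult), part C — 78a1, 174d1, 3758d1 (and `14a1`, in `TwoAdicInstances158774g.lean`)

HONEST FRAMING (cell `bsd-2adic`, run/shared/lean/pub/bsd-2adic/, D-0036 / D-0054; memo
`HOME/mult/PROOF-GVMULT.md` + ADDENDUM-1): every anchor `A` here is a Cremona curve with `2 ‖ N_A`,
NON-SPLIT multiplicative at `2`, squarefree conductor with `LAW(N_A) = 0`, negative discriminant and ONE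
rational point of order `2` (integral abscissa, Greenberg type B — a Prop-5.14 point); its cyclotomic
invariants `(torsion, μ = 0, λ = 0)` come from GEN-2's `anchor_invariants_of_prop514_nonsplit` given
the displayed K11a at `A`, `hper₀` and the certificates `λ_an(A) = 0`, `μ_an(A) = 0` (STEP-0 GVM kit
j244761: `(μ, λ)_an = (0, 0)` at 30a, 46a, 78a, 142c, 174d, 206a, 1454a). This file only DECIDES
THE CURVE DATA (minimality, ellipticity, multiplicative non-split reduction at `2`, conductor, the unique
type-B `2`-torsion point, `2 ∣ #Ẽ(𝔽_ℓ)` at good odd `ℓ`) for use by the per-class target files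
`TwoAdicInstancesGVM<class>.lean`. Nothing asserted beyond kernel-decided arithmetic; nothing booked.
References: [SilvermanAEC2009] VII.1.1, VII.5.1, VII.3.1; [Silverman1994] IV.10.2; [CremonaAlgorithms1997] Table 1.
-/

set_option autoImplicit false

open IsDedekindDomain WeierstrassCurve Literature.NumberTheory.EllipticCurves
  Literature.NumberTheory.EllipticCurves.ModularForms
  Literature.NumberTheory.EllipticCurves.Rank1Residual
  Literature.NumberTheory.EllipticCurves.Rank1Residual.Typed
  Literature.NumberTheory.EllipticCurves.Greenberg1999
  Literature.NumberTheory.EllipticCurves.PolyCert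
  Literature.NumberTheory.EllipticCurves.Rank1Residual.X11RankOneCertificates
  Summit.BirchSwinnertonDyer.Rank1Residual.X1.MuPart
  Summit.BirchSwinnertonDyer.Rank1Residual.X1.ParitySqueeze
  Summit.BirchSwinnertonDyer.Rank1Residual.X5.O1

open CongruenceSubgroup
open scoped MatrixGroups ModularForm

namespace Summit.BirchSwinnertonDyer.Rank1Residual.X5.Instances

/-- Cremona `78a1` = `[1, 1, 0, -19, 685]` (integer model). [cite: CremonaAlgorithms1997, Table 1] -/
abbrev M78a1 : WeierstrassCurve ℤ := ⟨1, 1, 0, -19, 685⟩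
/-- `78a1 / ℚ`. [cite: CremonaAlgorithms1997, Table 1] -/
abbrev c78a1 : WeierstrassCurve ℚ := M78a1.baseChange ℚ
/-- `Δ(78a1)` (factorisation `{2: 16, 3: 5, 13: 1}`, negative). [cite: CremonaAlgorithms1997, Table 1] -/
theorem M78a1_Δ : M78a1.Δ = -207028224 := by decide
/-- `c₄(78a1)` (coprime to `Δ`: semistable model). [cite: CremonaAlgorithms1997, Table 1] -/
theorem M78a1_c₄ : M78a1.c₄ = 937 := by decide
/-- `78a1` is an elliptic curve. [cite: CremonaAlgorithms1997, Table 1] -/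
instance c78a1_isElliptic : c78a1.IsElliptic := by
  rw [WeierstrassCurve.isElliptic_iff, baseChange_int_Δ, M78a1_Δ]; norm_num
/-- Cremona's model `78a1` is globally minimal (`gcd(Δ, c₄) = 1`). [cite: SilvermanAEC2009, VII.1 Remark 1.1] -/
instance c78a1_isGloballyMinimal : c78a1.IsGloballyMinimal :=
  isGloballyMinimal_baseChange_int_of_gcd_eq_one 1 1 0 (-19) 685 (by decide)
/-- `Δ(78a1)`, `c₄(78a1)` coprime. [cite: SilvermanAEC2009, VII.5 Prop. 5.1(b)] -/
theorem M78a1_coprime : IsCoprime M78a1.Δ M78a1.c₄ := by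
  rw [M78a1_Δ, M78a1_c₄, Int.isCoprime_iff_gcd_eq_one]; decide
/-- **`78a1` is multiplicative at `2`** (`2 ∣ Δ`, `2 ∤ c₄`). [cite: SilvermanAEC2009, VII.5 Prop. 5.1(b)] -/
theorem mult_two_78a1 : Mult c78a1 2 := by
  have hgen : Rat.HeightOneSpectrum.natGenerator
      ((Rat.HeightOneSpectrum.primesEquiv (R := ℤ)).symm ⟨2, Nat.prime_two⟩) = 2 :=
    Literature.NumberTheory.EllipticCurves.Rat.natGenerator_primesEquiv_symm ⟨2, Nat.prime_two⟩
  have hm := hasMultiplicativeReductionAt_baseChange_int_of_isCoprime M78a1 M78a1_coprime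
    (v := (Rat.HeightOneSpectrum.primesEquiv (R := ℤ)).symm ⟨2, Nat.prime_two⟩)
    (by rw [hgen, M78a1_Δ]; decide)
  exact (hasMultiplicativeReductionAtPrime_iff_hasMultiplicativeReductionAt_holds c78a1
    ⟨2, Nat.prime_two⟩).mpr hm
/-- `78a1 mod 2`. [folklore] -/
theorem M78a1_mod_two : M78a1.map (Int.castRingHom (ZMod 2)) = ⟨1, 1, 0, 1, 1⟩ := by
  ext <;> decide
/-- **`78a1` is NON-SPLIT multiplicative at `2`** (node quadratic `X² + X + 1` has no root in `𝔽₂`).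
[cite: SilvermanAEC2009, VII.5 Prop. 5.1(b)] -/
theorem not_split_two_78a1 : ¬ c78a1.HasSplitMultiplicativeReductionAtPrime 2 := by
  have hint : integralModelInt c78a1 = M78a1 := integralModelInt_baseChange_int M78a1
  have hΔ : ((2 : ℕ) : ℤ) ∣ (integralModelInt c78a1).Δ := by rw [hint, M78a1_Δ]; decide
  have hc₄ : ¬ ((2 : ℕ) : ℤ) ∣ (integralModelInt c78a1).c₄ := by rw [hint, M78a1_c₄]; decide
  rw [LocalTorsionMult.hasSplitMultiplicativeReductionAtPrime_iff_splits_integralModelInt c78a1 2 hΔ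
    hc₄, hint, M78a1_mod_two]
  dsimp only
  rw [sub_eq_add_neg, ← Polynomial.C_neg]
  exact not_splits_quadratic_F2 (by decide) (by decide) (by decide)
/-- **The conductor of `78a1` is `78`** (semistable; Silverman ATAEC IV.10.2). [cite: CremonaAlgorithms1997, Table 1] -/
theorem conductorNorm_78a1 : c78a1.conductorNorm ℤ = 78 := by
  refine conductorNorm_baseChange_int_of_isCoprime M78a1 M78a1_coprime (k := 16) ?_ ?_ ?_
  · rw [Nat.squarefree_iff_nodup_primeFactorsList (by norm_num)]; simp
  · rw [M78a1_Δ]; decide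
  · rw [M78a1_Δ]; decide
/-- The coefficients of `78a1 / ℚ` (unfolded). [cite: CremonaAlgorithms1997, Table 1] -/
theorem c78a1_eq : c78a1 = ⟨1, 1, 0, -19, 685⟩ := by
  rw [c78a1, baseChange_int_eq]; norm_num
/-- `b₂, b₄, b₆` of `78a1`; `2`-division cubic `= (x − (-10))(4x² + (-35)x + (274))`. [cite: SilvermanAEC2009, III.1] -/
theorem c78a1_b : c78a1.b₂ = 5 ∧ c78a1.b₄ = -38 ∧ c78a1.b₆ = 2740 := by
  rw [c78a1_eq]
  simp only [WeierstrassCurve.b₂, WeierstrassCurve.b₄, WeierstrassCurve.b₆]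
  norm_num
/-- The rational point `(-10, 5)` of order `2` on `78a1`. [cite: CremonaAlgorithms1997, Table 1] -/
theorem c78a1_P : c78a1.toAffine.Equation (-10) 5 ∧
    2 * (5 : ℚ) + c78a1.a₁ * (-10) + c78a1.a₃ = 0 := by
  rw [c78a1_eq, WeierstrassCurve.Affine.equation_iff]; norm_num
/-- **`(-10, 5)` is the ONLY rational point of order `2` on `78a1`** (cofactor of negative discriminant).
[cite: SilvermanAEC2009, III.2.3] -/
theorem c78a1_unique : HasUniqueRationalTwoTorsionX c78a1 (-10) := by
  refine ⟨⟨5, c78a1_P⟩, fun z hz ↦ ?_⟩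
  have hc := cubic_eq_zero_of_hasRationalTwoTorsionX hz
  obtain ⟨hb₂, hb₄, hb₆⟩ := c78a1_b
  rw [hb₂, hb₄, hb₆] at hc
  have hfac : (z - (-10)) * (4 * z ^ 2 + (-35) * z + 274) = 0 := by linear_combination hc
  rcases mul_eq_zero.mp hfac with h | h
  · linarith
  · nlinarith [sq_nonneg (8 * z + (-35))]
/-- **`(-10, 5)` is "odd"**: the only real root of the `2`-division cubic. [cite: GreenbergLNM1716, §5 Remark (chunk p0174)] -/
theorem c78a1_odd : TwoTorsionOdd c78a1 (-10) := by
  intro r hr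
  obtain ⟨hb₂, hb₄, hb₆⟩ := c78a1_b
  rw [hb₂, hb₄, hb₆] at hr
  push_cast at hr
  have hfac : (r - (-10)) * (4 * r ^ 2 + (-35) * r + 274) = 0 := by linear_combination hr
  rcases mul_eq_zero.mp hfac with h | h
  · push_cast; linarith
  · nlinarith [sq_nonneg (8 * r + (-35))]
/-- `2 ∣ #Ẽ(𝔽_ℓ)` for `78a1` at every good odd prime `ℓ` (a rational `2`-torsion point). [cite: SilvermanAEC2009, VII.3.1(b)] -/
theorem two_dvd_reductionPointCount_78a1 {ℓ : ℕ} [Fact ℓ.Prime] (hℓ : 3 ≤ ℓ)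
    (hΔ : ¬ (ℓ : ℤ) ∣ (-207028224 : ℤ)) : 2 ∣ c78a1.reductionPointCount ℓ :=
  two_dvd_reductionPointCount_of_hasRationalTwoTorsionX ⟨5, c78a1_P⟩ hℓ
    (by rw [minimalDiscriminantInt_baseChange_int, M78a1_Δ]; exact hΔ)

/-- Cremona `174d1` = `[1, 0, 1, 0, -2]` (integer model). [cite: CremonaAlgorithms1997, Table 1] -/
abbrev M174d1 : WeierstrassCurve ℤ := ⟨1, 0, 1, 0, -2⟩
/-- `174d1 / ℚ`. [cite: CremonaAlgorithms1997, Table 1] -/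
abbrev c174d1 : WeierstrassCurve ℚ := M174d1.baseChange ℚ
/-- `Δ(174d1)` (factorisation `{2: 4, 3: 1, 29: 1}`, negative). [cite: CremonaAlgorithms1997, Table 1] -/
theorem M174d1_Δ : M174d1.Δ = -1392 := by decide
/-- `c₄(174d1)` (coprime to `Δ`: semistable model). [cite: CremonaAlgorithms1997, Table 1] -/
theorem M174d1_c₄ : M174d1.c₄ = -23 := by decide
/-- `174d1` is an elliptic curve. [cite: CremonaAlgorithms1997, Table 1] -/
instance c174d1_isElliptic : c174d1.IsElliptic := by
  rw [WeierstrassCurve.isElliptic_iff, baseChange_int_Δ, M174d1_Δ]; norm_num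
/-- Cremona's model `174d1` is globally minimal (`gcd(Δ, c₄) = 1`). [cite: SilvermanAEC2009, VII.1 Remark 1.1] -/
instance c174d1_isGloballyMinimal : c174d1.IsGloballyMinimal :=
  isGloballyMinimal_baseChange_int_of_gcd_eq_one 1 0 1 0 (-2) (by decide)
/-- `Δ(174d1)`, `c₄(174d1)` coprime. [cite: SilvermanAEC2009, VII.5 Prop. 5.1(b)] -/
theorem M174d1_coprime : IsCoprime M174d1.Δ M174d1.c₄ := by
  rw [M174d1_Δ, M174d1_c₄, Int.isCoprime_iff_gcd_eq_one]; decide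
/-- **`174d1` is multiplicative at `2`** (`2 ∣ Δ`, `2 ∤ c₄`). [cite: SilvermanAEC2009, VII.5 Prop. 5.1(b)] -/
theorem mult_two_174d1 : Mult c174d1 2 := by
  have hgen : Rat.HeightOneSpectrum.natGenerator
      ((Rat.HeightOneSpectrum.primesEquiv (R := ℤ)).symm ⟨2, Nat.prime_two⟩) = 2 :=
    Literature.NumberTheory.EllipticCurves.Rat.natGenerator_primesEquiv_symm ⟨2, Nat.prime_two⟩
  have hm := hasMultiplicativeReductionAt_baseChange_int_of_isCoprime M174d1 M174d1_coprime
    (v := (Rat.HeightOneSpectrum.primesEquiv (R := ℤ)).symm ⟨2, Nat.prime_two⟩)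
    (by rw [hgen, M174d1_Δ]; decide)
  exact (hasMultiplicativeReductionAtPrime_iff_hasMultiplicativeReductionAt_holds c174d1
    ⟨2, Nat.prime_two⟩).mpr hm
/-- `174d1 mod 2`. [folklore] -/
theorem M174d1_mod_two : M174d1.map (Int.castRingHom (ZMod 2)) = ⟨1, 0, 1, 0, 0⟩ := by
  ext <;> decide
/-- **`174d1` is NON-SPLIT multiplicative at `2`** (node quadratic `X² + X + 1` has no root in `𝔽₂`).
[cite: SilvermanAEC2009, VII.5 Prop. 5.1(b)] -/
theorem not_split_two_174d1 : ¬ c174d1.HasSplitMultiplicativeReductionAtPrime 2 := by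
  have hint : integralModelInt c174d1 = M174d1 := integralModelInt_baseChange_int M174d1
  have hΔ : ((2 : ℕ) : ℤ) ∣ (integralModelInt c174d1).Δ := by rw [hint, M174d1_Δ]; decide
  have hc₄ : ¬ ((2 : ℕ) : ℤ) ∣ (integralModelInt c174d1).c₄ := by rw [hint, M174d1_c₄]; decide
  rw [LocalTorsionMult.hasSplitMultiplicativeReductionAtPrime_iff_splits_integralModelInt c174d1 2 hΔ
    hc₄, hint, M174d1_mod_two]
  dsimp only
  rw [sub_eq_add_neg, ← Polynomial.C_neg]
  exact not_splits_quadratic_F2 (by decide) (by decide) (by decide)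
/-- **The conductor of `174d1` is `174`** (semistable; Silverman ATAEC IV.10.2). [cite: CremonaAlgorithms1997, Table 1] -/
theorem conductorNorm_174d1 : c174d1.conductorNorm ℤ = 174 := by
  refine conductorNorm_baseChange_int_of_isCoprime M174d1 M174d1_coprime (k := 4) ?_ ?_ ?_
  · rw [Nat.squarefree_iff_nodup_primeFactorsList (by norm_num)]; simp
  · rw [M174d1_Δ]; decide
  · rw [M174d1_Δ]; decide
/-- The coefficients of `174d1 / ℚ` (unfolded). [cite: CremonaAlgorithms1997, Table 1] -/
theorem c174d1_eq : c174d1 = ⟨1, 0, 1, 0, -2⟩ := by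
  rw [c174d1, baseChange_int_eq]; norm_num
/-- `b₂, b₄, b₆` of `174d1`; `2`-division cubic `= (x − (1))(4x² + (5)x + (7))`. [cite: SilvermanAEC2009, III.1] -/
theorem c174d1_b : c174d1.b₂ = 1 ∧ c174d1.b₄ = 1 ∧ c174d1.b₆ = -7 := by
  rw [c174d1_eq]
  simp only [WeierstrassCurve.b₂, WeierstrassCurve.b₄, WeierstrassCurve.b₆]
  norm_num
/-- The rational point `(1, -1)` of order `2` on `174d1`. [cite: CremonaAlgorithms1997, Table 1] -/
theorem c174d1_P : c174d1.toAffine.Equation 1 (-1) ∧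
    2 * ((-1) : ℚ) + c174d1.a₁ * 1 + c174d1.a₃ = 0 := by
  rw [c174d1_eq, WeierstrassCurve.Affine.equation_iff]; norm_num
/-- **`(1, -1)` is the ONLY rational point of order `2` on `174d1`** (cofactor of negative discriminant).
[cite: SilvermanAEC2009, III.2.3] -/
theorem c174d1_unique : HasUniqueRationalTwoTorsionX c174d1 1 := by
  refine ⟨⟨(-1), c174d1_P⟩, fun z hz ↦ ?_⟩
  have hc := cubic_eq_zero_of_hasRationalTwoTorsionX hz
  obtain ⟨hb₂, hb₄, hb₆⟩ := c174d1_b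
  rw [hb₂, hb₄, hb₆] at hc
  have hfac : (z - 1) * (4 * z ^ 2 + 5 * z + 7) = 0 := by linear_combination hc
  rcases mul_eq_zero.mp hfac with h | h
  · linarith
  · nlinarith [sq_nonneg (8 * z + 5)]
/-- **`(1, -1)` is "odd"**: the only real root of the `2`-division cubic. [cite: GreenbergLNM1716, §5 Remark (chunk p0174)] -/
theorem c174d1_odd : TwoTorsionOdd c174d1 1 := by
  intro r hr
  obtain ⟨hb₂, hb₄, hb₆⟩ := c174d1_b
  rw [hb₂, hb₄, hb₆] at hr
  push_cast at hr
  have hfac : (r - 1) * (4 * r ^ 2 + 5 * r + 7) = 0 := by linear_combination hr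
  rcases mul_eq_zero.mp hfac with h | h
  · push_cast; linarith
  · nlinarith [sq_nonneg (8 * r + 5)]
/-- `2 ∣ #Ẽ(𝔽_ℓ)` for `174d1` at every good odd prime `ℓ` (a rational `2`-torsion point). [cite: SilvermanAEC2009, VII.3.1(b)] -/
theorem two_dvd_reductionPointCount_174d1 {ℓ : ℕ} [Fact ℓ.Prime] (hℓ : 3 ≤ ℓ)
    (hΔ : ¬ (ℓ : ℤ) ∣ (-1392 : ℤ)) : 2 ∣ c174d1.reductionPointCount ℓ :=
  two_dvd_reductionPointCount_of_hasRationalTwoTorsionX ⟨(-1), c174d1_P⟩ hℓ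
    (by rw [minimalDiscriminantInt_baseChange_int, M174d1_Δ]; exact hΔ)

/-- Cremona `3758d1` = `[1, 0, 1, 28, -30]` (integer model). [cite: CremonaAlgorithms1997, Table 1] -/
abbrev M3758d1 : WeierstrassCurve ℤ := ⟨1, 0, 1, 28, -30⟩
/-- `3758d1 / ℚ`. [cite: CremonaAlgorithms1997, Table 1] -/
abbrev c3758d1 : WeierstrassCurve ℚ := M3758d1.baseChange ℚ
/-- `Δ(3758d1)` (factorisation `{2: 10, 1879: 1}`, negative). [cite: CremonaAlgorithms1997, Table 1] -/
theorem M3758d1_Δ : M3758d1.Δ = -1924096 := by decide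
/-- `c₄(3758d1)` (coprime to `Δ`: semistable model). [cite: CremonaAlgorithms1997, Table 1] -/
theorem M3758d1_c₄ : M3758d1.c₄ = -1367 := by decide
/-- `3758d1` is an elliptic curve. [cite: CremonaAlgorithms1997, Table 1] -/
instance c3758d1_isElliptic : c3758d1.IsElliptic := by
  rw [WeierstrassCurve.isElliptic_iff, baseChange_int_Δ, M3758d1_Δ]; norm_num
/-- Cremona's model `3758d1` is globally minimal (`gcd(Δ, c₄) = 1`). [cite: SilvermanAEC2009, VII.1 Remark 1.1] -/
instance c3758d1_isGloballyMinimal : c3758d1.IsGloballyMinimal :=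
  isGloballyMinimal_baseChange_int_of_gcd_eq_one 1 0 1 28 (-30) (by decide)
/-- `Δ(3758d1)`, `c₄(3758d1)` coprime. [cite: SilvermanAEC2009, VII.5 Prop. 5.1(b)] -/
theorem M3758d1_coprime : IsCoprime M3758d1.Δ M3758d1.c₄ := by
  rw [M3758d1_Δ, M3758d1_c₄, Int.isCoprime_iff_gcd_eq_one]; decide
/-- **`3758d1` is multiplicative at `2`** (`2 ∣ Δ`, `2 ∤ c₄`). [cite: SilvermanAEC2009, VII.5 Prop. 5.1(b)] -/
theorem mult_two_3758d1 : Mult c3758d1 2 := by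
  have hgen : Rat.HeightOneSpectrum.natGenerator
      ((Rat.HeightOneSpectrum.primesEquiv (R := ℤ)).symm ⟨2, Nat.prime_two⟩) = 2 :=
    Literature.NumberTheory.EllipticCurves.Rat.natGenerator_primesEquiv_symm ⟨2, Nat.prime_two⟩
  have hm := hasMultiplicativeReductionAt_baseChange_int_of_isCoprime M3758d1 M3758d1_coprime
    (v := (Rat.HeightOneSpectrum.primesEquiv (R := ℤ)).symm ⟨2, Nat.prime_two⟩)
    (by rw [hgen, M3758d1_Δ]; decide)
  exact (hasMultiplicativeReductionAtPrime_iff_hasMultiplicativeReductionAt_holds c3758d1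
    ⟨2, Nat.prime_two⟩).mpr hm
/-- `3758d1 mod 2`. [folklore] -/
theorem M3758d1_mod_two : M3758d1.map (Int.castRingHom (ZMod 2)) = ⟨1, 0, 1, 0, 0⟩ := by
  ext <;> decide
/-- **`3758d1` is NON-SPLIT multiplicative at `2`** (node quadratic `X² + X + 1` has no root in `𝔽₂`).
[cite: SilvermanAEC2009, VII.5 Prop. 5.1(b)] -/
theorem not_split_two_3758d1 : ¬ c3758d1.HasSplitMultiplicativeReductionAtPrime 2 := by
  have hint : integralModelInt c3758d1 = M3758d1 := integralModelInt_baseChange_int M3758d1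
  have hΔ : ((2 : ℕ) : ℤ) ∣ (integralModelInt c3758d1).Δ := by rw [hint, M3758d1_Δ]; decide
  have hc₄ : ¬ ((2 : ℕ) : ℤ) ∣ (integralModelInt c3758d1).c₄ := by rw [hint, M3758d1_c₄]; decide
  rw [LocalTorsionMult.hasSplitMultiplicativeReductionAtPrime_iff_splits_integralModelInt c3758d1 2 hΔ
    hc₄, hint, M3758d1_mod_two]
  dsimp only
  rw [sub_eq_add_neg, ← Polynomial.C_neg]
  exact not_splits_quadratic_F2 (by decide) (by decide) (by decide)
/-- **The conductor of `3758d1` is `3758`** (semistable; Silverman ATAEC IV.10.2). [cite: CremonaAlgorithms1997, Table 1] -/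
theorem conductorNorm_3758d1 : c3758d1.conductorNorm ℤ = 3758 := by
  refine conductorNorm_baseChange_int_of_isCoprime M3758d1 M3758d1_coprime (k := 10) ?_ ?_ ?_
  · rw [Nat.squarefree_iff_nodup_primeFactorsList (by norm_num)]; simp
  · rw [M3758d1_Δ]; decide
  · rw [M3758d1_Δ]; decide
/-- The coefficients of `3758d1 / ℚ` (unfolded). [cite: CremonaAlgorithms1997, Table 1] -/
theorem c3758d1_eq : c3758d1 = ⟨1, 0, 1, 28, -30⟩ := by
  rw [c3758d1, baseChange_int_eq]; norm_num
/-- `b₂, b₄, b₆` of `3758d1`; `2`-division cubic `= (x − (1))(4x² + (5)x + (119))`. [cite: SilvermanAEC2009, III.1] -/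
theorem c3758d1_b : c3758d1.b₂ = 1 ∧ c3758d1.b₄ = 57 ∧ c3758d1.b₆ = -119 := by
  rw [c3758d1_eq]
  simp only [WeierstrassCurve.b₂, WeierstrassCurve.b₄, WeierstrassCurve.b₆]
  norm_num
/-- The rational point `(1, -1)` of order `2` on `3758d1`. [cite: CremonaAlgorithms1997, Table 1] -/
theorem c3758d1_P : c3758d1.toAffine.Equation 1 (-1) ∧
    2 * ((-1) : ℚ) + c3758d1.a₁ * 1 + c3758d1.a₃ = 0 := by
  rw [c3758d1_eq, WeierstrassCurve.Affine.equation_iff]; norm_num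
/-- **`(1, -1)` is the ONLY rational point of order `2` on `3758d1`** (cofactor of negative discriminant).
[cite: SilvermanAEC2009, III.2.3] -/
theorem c3758d1_unique : HasUniqueRationalTwoTorsionX c3758d1 1 := by
  refine ⟨⟨(-1), c3758d1_P⟩, fun z hz ↦ ?_⟩
  have hc := cubic_eq_zero_of_hasRationalTwoTorsionX hz
  obtain ⟨hb₂, hb₄, hb₆⟩ := c3758d1_b
  rw [hb₂, hb₄, hb₆] at hc
  have hfac : (z - 1) * (4 * z ^ 2 + 5 * z + 119) = 0 := by linear_combination hc
  rcases mul_eq_zero.mp hfac with h | h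
  · linarith
  · nlinarith [sq_nonneg (8 * z + 5)]
/-- **`(1, -1)` is "odd"**: the only real root of the `2`-division cubic. [cite: GreenbergLNM1716, §5 Remark (chunk p0174)] -/
theorem c3758d1_odd : TwoTorsionOdd c3758d1 1 := by
  intro r hr
  obtain ⟨hb₂, hb₄, hb₆⟩ := c3758d1_b
  rw [hb₂, hb₄, hb₆] at hr
  push_cast at hr
  have hfac : (r - 1) * (4 * r ^ 2 + 5 * r + 119) = 0 := by linear_combination hr
  rcases mul_eq_zero.mp hfac with h | h
  · push_cast; linarith
  · nlinarith [sq_nonneg (8 * r + 5)]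
/-- `2 ∣ #Ẽ(𝔽_ℓ)` for `3758d1` at every good odd prime `ℓ` (a rational `2`-torsion point). [cite: SilvermanAEC2009, VII.3.1(b)] -/
theorem two_dvd_reductionPointCount_3758d1 {ℓ : ℕ} [Fact ℓ.Prime] (hℓ : 3 ≤ ℓ)
    (hΔ : ¬ (ℓ : ℤ) ∣ (-1924096 : ℤ)) : 2 ∣ c3758d1.reductionPointCount ℓ :=
  two_dvd_reductionPointCount_of_hasRationalTwoTorsionX ⟨(-1), c3758d1_P⟩ hℓ
    (by rw [minimalDiscriminantInt_baseChange_int, M3758d1_Δ]; exact hΔ)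

end Summit.BirchSwinnertonDyer.Rank1Residual.X5.Instances
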